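import Summits.ValiantsHypothesis.ValiantsHypothesis.Theorems.LacunarySymmetroidMatrixDescartesCensusDoorA34SheetWindowGramHermitian

/-!
# `MatrixDescartes` census — DOOR A at `(3,4)`: the SEMIDEFINITE CELL'S MIDDLE BLOCK AT EVERY SCALE RATIO — five middle roots forbid a later top-window root
# (the flag `(γ_M, γ_T) = (5, ≥ 1)` is impossible in the semidefinite cell on window supports, with no hypothesis on the core)

HONEST FRAMING.  Object-search cell `pub-symmetroid`, engine seat `val-sym-eng-2` (g11); helper row beside the registered strata line
`Cruxes/DoorA34/Lines/strata.lean` on stmt-ValiantsHypothesis-19980 (`DoorA34 = PosRootLawAt 3 4 18`: OPEN, typed, never asserted here), stub `stub_nullTopCeiling`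
(`det S₃ = 0 ⇒ ≤ 17`).  In the SEMIDEFINITE inertia cell the singular rank-two top letter is congruent to `diag(α, β, 0)`, `α, β ≥ 0`; the null-top pencil
`F + X^N·diag(α, β, 0)` over the three-letter core `F = Σₗ X^{dₗ}Sₗ` has middle block `tr(adj F·S₃) = α·adj F₀₀ + β·adj F₁₁` and top block `αβ·F₂₂`
(`Census.det_pencil_nullTop_eq_blocks`).  This file reads the companion HERMITIAN ORIENTATION LAW (…SheetWindowGramHermitian, `orientation_law_hermitian`) on it:

* `middleBlock_semidef_eq` — `α·adj F₀₀ + β·adj F₁₁ = F₂₂·(αF₁₁ + βF₀₀) − (√α·F₁₂)² − (√β·F₀₂)²`, a four-trinomial six-nomial `T·L − A² − B²`;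
* **`topWindow_ne_zero_beyond_semidef_middle_roots`** — window support `(0, d₁, d₂)` (`0 < d₁`, `2d₁ < d₂`), `α, β ≥ 0`: if the middle block has at least FIVE
  distinct positive roots then the top window `F₂₂ = e₂ᵀ F e₂` vanishes at NO `x` beyond all its real roots.  This is the door-p3 FLAG LAW of the semidefinite cell
  (`Census.SemidefFlag.flagLaw_semidef_no_five_one`, which needs a type-`(−)` core root below the five) WITHOUT any hypothesis on the core's roots, and the
  two-scale law `Census.diag_ne_zero_beyond_roots` (`β = 0`) at EVERY ratio `α : β` — the g10 report's §6(d) sentence «semidefinite top letter of ANY scale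
  ratio: γ₂ = 0» as a theorem.  So in the semidefinite cell on window supports a window-separated anatomy counts `≤ 9+1+5+1+0 = 16` or `≤ 9+1+4+1+2 = 17`
  (prose: the count itself is asymptotic in `N` and is not typed here);
* `semidef_middleBlock_orientation` — the middle block is negative at `0⁺` and positive at `+∞` (signs of its `x⁰`, `x^{2d₁}`, `x^{2d₂}` coefficients).

Nothing here bounds the sheet in the kernel; `DoorA34` and the three stubs stay OPEN; registers unchanged (`ζ_sym(3,4) ∈ {18,19}`); nothing on `MatrixDescartes`
(stmt-ValiantsHypothesis-18050) or on `VP ≠ VNP` — VP≠VNP not moved.  [folklore] `3 × 3` adjugate entries; the Hermitian orientation law.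
-/

-- `Summit.ValiantsHypothesis.ValiantsHypothesis.…` repeats a component by the D-0017 layout
-- (single-conjunct summit), which the `dupNamespace` linter flags; the name is mandated.
set_option linter.dupNamespace false

namespace Summit.ValiantsHypothesis.ValiantsHypothesis.Theorems.LacunarySymmetroidMatrixDescartes.Census

open scoped BigOperators Matrix
open Polynomial Finset

/-- The three-letter core on `(0, d₁, d₂)` written out. [folklore] -/
theorem corePencil_eq (d₁ d₂ : ℕ) (S : Fin 3 → Matrix (Fin 3) (Fin 3) ℝ) :
    (∑ l, (X : ℝ[X]) ^ (![0, d₁, d₂] : Fin 3 → ℕ) l • (S l).map C)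
      = (S 0).map C + (X : ℝ[X]) ^ d₁ • (S 1).map C + (X : ℝ[X]) ^ d₂ • (S 2).map C := by
  rw [Fin.sum_univ_three]
  simp only [Matrix.cons_val_zero, Matrix.cons_val_one, Matrix.cons_val_two, Matrix.tail_cons, Matrix.head_cons, pow_zero, one_smul]

/-- **The semidefinite middle block is a Hermitian six-nomial.**  For a real symmetric three-letter `3 × 3` core `F = Σₗ X^{dₗ}Sₗ` on `(0, d₁, d₂)` and `α, β ≥ 0`,
the middle block `α·adj F₀₀ + β·adj F₁₁ = tr(adj F · diag(α, β, 0))` of the null-top pencil `F + X^N·diag(α, β, 0)` equals `T·L − A² − B²` with the trinomials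
`T = F₂₂`, `L = αF₁₁ + βF₀₀`, `A = √α·F₁₂`, `B = √β·F₀₂`. [folklore] -/
theorem middleBlock_semidef_eq (d₁ d₂ : ℕ) (S : Fin 3 → Matrix (Fin 3) (Fin 3) ℝ) (hS : ∀ l, (S l).IsSymm) (α β : ℝ) (hα : 0 ≤ α) (hβ : 0 ≤ β) :
    C α * (∑ l, (X : ℝ[X]) ^ (![0, d₁, d₂] : Fin 3 → ℕ) l • (S l).map C).adjugate 0 0
        + C β * (∑ l, (X : ℝ[X]) ^ (![0, d₁, d₂] : Fin 3 → ℕ) l • (S l).map C).adjugate 1 1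
      = (C (S 0 2 2) + C (S 1 2 2) * X ^ d₁ + C (S 2 2 2) * X ^ d₂)
          * (C (α * S 0 1 1 + β * S 0 0 0) + C (α * S 1 1 1 + β * S 1 0 0) * X ^ d₁ + C (α * S 2 1 1 + β * S 2 0 0) * X ^ d₂)
        - (C (Real.sqrt α * S 0 1 2) + C (Real.sqrt α * S 1 1 2) * X ^ d₁ + C (Real.sqrt α * S 2 1 2) * X ^ d₂) ^ 2
        - (C (Real.sqrt β * S 0 0 2) + C (Real.sqrt β * S 1 0 2) * X ^ d₁ + C (Real.sqrt β * S 2 0 2) * X ^ d₂) ^ 2 := by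
  have h21 : ∀ l, S l 2 1 = S l 1 2 := fun l => by simpa [Matrix.transpose_apply] using congrFun (congrFun (hS l) 1) 2
  have h20 : ∀ l, S l 2 0 = S l 0 2 := fun l => by simpa [Matrix.transpose_apply] using congrFun (congrFun (hS l) 0) 2
  have hA : (C (Real.sqrt α) : ℝ[X]) ^ 2 = C α := by rw [← map_pow, Real.sq_sqrt hα]
  have hB : (C (Real.sqrt β) : ℝ[X]) ^ 2 = C β := by rw [← map_pow, Real.sq_sqrt hβ]
  rw [corePencil_eq, Matrix.adjugate_fin_three]
  simp only [Matrix.of_apply, Matrix.cons_val', Matrix.cons_val_zero, Matrix.cons_val_one, Matrix.empty_val', Matrix.cons_val_fin_one,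
    Matrix.add_apply, Matrix.smul_apply, Matrix.map_apply, smul_eq_mul, h21, h20, map_mul, map_add]
  linear_combination (C (S 0 1 2) + C (S 1 1 2) * X ^ d₁ + C (S 2 1 2) * X ^ d₂) ^ 2 * hA
    + (C (S 0 0 2) + C (S 1 0 2) * X ^ d₁ + C (S 2 0 2) * X ^ d₂) ^ 2 * hB

/-- The `(2,2)` entry (the TOP WINDOW `e₂ᵀ F e₂`) of the evaluated core. [folklore] -/
theorem corePencil_eval_two_two (d₁ d₂ : ℕ) (S : Fin 3 → Matrix (Fin 3) (Fin 3) ℝ) (x : ℝ) :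
    (∑ l, x ^ (![0, d₁, d₂] : Fin 3 → ℕ) l • S l) 2 2 = S 0 2 2 + x ^ d₁ * S 1 2 2 + x ^ d₂ * S 2 2 2 := by
  rw [Fin.sum_univ_three]
  simp only [Matrix.add_apply, Matrix.smul_apply, smul_eq_mul, Matrix.cons_val_zero, Matrix.cons_val_one, Matrix.cons_val_two,
    Matrix.tail_cons, Matrix.head_cons, pow_zero, one_mul]

/-- **★ SEMIDEFINITE CELL, EVERY SCALE RATIO: no top-window root beyond five middle-block roots.**  Let `F = Σₗ X^{dₗ}Sₗ` be a real symmetric three-letter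
`3 × 3` core on a WINDOW support `(0, d₁, d₂)` (`0 < d₁`, `2d₁ < d₂`) and `α, β ≥ 0` (the null-top pencil `F + X^N·diag(α, β, 0)` of the SEMIDEFINITE inertia cell:
middle block `α·adj F₀₀ + β·adj F₁₁`, top block `αβ·F₂₂`).  If the middle block has at least FIVE distinct positive roots, then the top window `F₂₂ = e₂ᵀ F e₂` does not
vanish at any `x` beyond all real roots of the middle block — the flag `(γ_M, γ_T) = (5, ≥ 1)` of a window-separated anatomy is impossible in the semidefinite cell,
whatever the ratio `α : β` and with NO hypothesis on the core's roots (compare `Census.SemidefFlag.flagLaw_semidef_no_five_one`, which needs a type-`(−)` core root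
below the five; compare `Census.diag_ne_zero_beyond_roots`, the two-scale case `β = 0`). [folklore] -/
theorem topWindow_ne_zero_beyond_semidef_middle_roots (d₁ d₂ : ℕ) (hd₁ : 0 < d₁) (hw : 2 * d₁ < d₂) (S : Fin 3 → Matrix (Fin 3) (Fin 3) ℝ)
    (hS : ∀ l, (S l).IsSymm) (α β : ℝ) (hα : 0 ≤ α) (hβ : 0 ≤ β)
    (h5 : 5 ≤ ((C α * (∑ l, (X : ℝ[X]) ^ (![0, d₁, d₂] : Fin 3 → ℕ) l • (S l).map C).adjugate 0 0
        + C β * (∑ l, (X : ℝ[X]) ^ (![0, d₁, d₂] : Fin 3 → ℕ) l • (S l).map C).adjugate 1 1).roots.toFinset.filter (fun t => 0 < t)).card)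
    (x : ℝ) (hbeyond : ∀ z, (C α * (∑ l, (X : ℝ[X]) ^ (![0, d₁, d₂] : Fin 3 → ℕ) l • (S l).map C).adjugate 0 0
        + C β * (∑ l, (X : ℝ[X]) ^ (![0, d₁, d₂] : Fin 3 → ℕ) l • (S l).map C).adjugate 1 1).IsRoot z → z < x) :
    (∑ l, x ^ (![0, d₁, d₂] : Fin 3 → ℕ) l • S l) 2 2 ≠ 0 := by
  rw [middleBlock_semidef_eq d₁ d₂ S hS α β hα hβ] at h5 hbeyond
  rw [corePencil_eval_two_two]
  exact (trinomials_ne_zero_beyond_roots d₁ d₂ hd₁ hw _ _ _ _ _ _ _ _ _ _ _ _ h5 x hbeyond).1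

/-- **Orientation of the semidefinite middle block.**  Same hypotheses: the middle block is NEGATIVE at `0⁺` and POSITIVE at `+∞` — its bottom coefficient
`α·adj(S₀)₀₀ + β·adj(S₀)₁₁` is `< 0`, its `x^{2d₁}` coefficient `α·adj(S₁)₀₀ + β·adj(S₁)₁₁` is `< 0` and its top coefficient `α·adj(S₂)₀₀ + β·adj(S₂)₁₁` is `> 0`
(so neither end letter's `{e₀,e₁}`-minors pair can be «definite the wrong way»). [folklore] -/
theorem semidef_middleBlock_orientation (d₁ d₂ : ℕ) (hd₁ : 0 < d₁) (hw : 2 * d₁ < d₂) (S : Fin 3 → Matrix (Fin 3) (Fin 3) ℝ)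
    (hS : ∀ l, (S l).IsSymm) (α β : ℝ) (hα : 0 ≤ α) (hβ : 0 ≤ β)
    (h5 : 5 ≤ ((C α * (∑ l, (X : ℝ[X]) ^ (![0, d₁, d₂] : Fin 3 → ℕ) l • (S l).map C).adjugate 0 0
        + C β * (∑ l, (X : ℝ[X]) ^ (![0, d₁, d₂] : Fin 3 → ℕ) l • (S l).map C).adjugate 1 1).roots.toFinset.filter (fun t => 0 < t)).card) :
    α * (S 0).adjugate 0 0 + β * (S 0).adjugate 1 1 < 0 ∧ α * (S 1).adjugate 0 0 + β * (S 1).adjugate 1 1 < 0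
      ∧ 0 < α * (S 2).adjugate 0 0 + β * (S 2).adjugate 1 1 := by
  rw [middleBlock_semidef_eq d₁ d₂ S hS α β hα hβ] at h5
  obtain ⟨h0, h1, h2⟩ := orientation_law_hermitian d₁ d₂ hd₁ hw _ _ _ _ _ _ _ _ _ _ _ _ h5
  have h21 : ∀ l, S l 2 1 = S l 1 2 := fun l => by simpa [Matrix.transpose_apply] using congrFun (congrFun (hS l) 1) 2
  have h20 : ∀ l, S l 2 0 = S l 0 2 := fun l => by simpa [Matrix.transpose_apply] using congrFun (congrFun (hS l) 0) 2
  have hsa : Real.sqrt α ^ 2 = α := Real.sq_sqrt hα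
  have hsb : Real.sqrt β ^ 2 = β := Real.sq_sqrt hβ
  have hadj : ∀ l, α * (S l).adjugate 0 0 + β * (S l).adjugate 1 1
      = S l 2 2 * (α * S l 1 1 + β * S l 0 0) - (Real.sqrt α * S l 1 2) ^ 2 - (Real.sqrt β * S l 0 2) ^ 2 := by
    intro l
    rw [Matrix.adjugate_fin_three]
    simp only [Matrix.of_apply, Matrix.cons_val', Matrix.cons_val_zero, Matrix.cons_val_one, Matrix.empty_val', Matrix.cons_val_fin_one,
      h21, h20]
    linear_combination (S l 1 2) ^ 2 * hsa + (S l 0 2) ^ 2 * hsb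
  rw [hadj 0, hadj 1, hadj 2]
  exact ⟨h0, h1, h2⟩

end Summit.ValiantsHypothesis.ValiantsHypothesis.Theorems.LacunarySymmetroidMatrixDescartes.Census
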